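import Summits.Ventures.Crystal3D.Theorems.StickyWulffConstantGenericWallFloorStackWalkFrames
import HarnessLib

/-!
# The stack ledger for NON-CHAIN pairs: full charge, no `#TC`, no arrivals

HONEST FRAMING. Part of the venture `Summits/Ventures/Crystal3D` (cell `crystal3d-full`), helper
`--supports` the crux `GenericWallFloor` (stmt-Ventures-19480) of `route-Ventures-StickyWulffConstant`,
registered line `WallLedgerG`, open stub `stub_twoSlabAdhesion` (general fillings).  The stack ledger
`twoSlabAdhesion_stackLedger` (`…StackLedger`) specialised to 19480-p1's NON-CHAIN pairs: mirror-closed frame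
families `𝓕₁ ∋ A₁` avoiding the linear lattice of `A₂` and `𝓕₂ ∋ A₂` avoiding that of `A₁` (this excludes
exactly the `Σ3ⁿ`-related pairs and implies non-co-axiality).  By `…StackWalkFrames` every walk keeps its
frames in the family of its grain, so no walk ends on the far clamped sample: the arrivals vanish.

**Theorem (`twoSlabAdhesion_stackLedger_nonChain`).**  Input BY NAME: the E1 row C12-55 (`ExactOnly`).  For
a non-chain pair, steep slots `u₁` (up) / `u₂` (down), `R₀ = 10`, explicit `C`, in EVERY cell of
`TwoSlabAdhesion` (hypotheses verbatim; arbitrary `1`-separated filling):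
`cross(P₁,X∖P₁) + cross(P₂,Y) ≤ D(Y) + (φ₁ + φ₂ − ½(κ₁+κ₂))πρ² + ½(LOST₁ + LOST₂ + DT₁₁) + C(1+h)ρ`,
`κᵢ = √2|⟪Aᵢuᵢ, e₃⟫| ≥ 1` — FULL charge (`½(κ₁+κ₂) ≥ 1 = c₀`), against 19480-p1's
`general_twoSlabAdhesion_nonChain` (constant `2/2809`, no residual, clean slivers) — with the residuals
`LOSTᵢ = #topsᵢ − #distinct walk endsᵢ` (coincident ends: multi-variant junctions / closed twin circuits) and
`DT₁₁` (degree-11 double ends).  Mechanism: as `…StackLedger`, plus `stackWalk_end_not_high/_not_low`.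

WHAT THIS IS NOT: not the stub (`ExactOnly` C12-55, `LOST`, `DT₁₁` remain; chain pairs excluded); F-C1 not
moved.
-/

noncomputable section

namespace Summit.Ventures.Crystal3D.Theorems

open Summit.Ventures.Crystal3D Finset
open Literature.MathematicalPhysics.StatisticalMechanics (fccStacking contactDeficiency)
open scoped InnerProductSpace

open scoped Classical in
/-- **The stack ledger.**  See the module docstring. -/
theorem twoSlabAdhesion_stackLedger_nonChain
    {s₀ : EuclideanSpace ℝ (Fin 3)} (hs₀ : s₀ ∈ fccSlots)
    (hcert : ExactOnly 0 (fccSlots.filter fun w => 0 < ⟪w, s₀⟫_ℝ))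
    (A₁ : EuclideanSpace ℝ (Fin 3) ≃ₗᵢ[ℝ] EuclideanSpace ℝ (Fin 3)) (t₁ : EuclideanSpace ℝ (Fin 3))
    (A₂ : EuclideanSpace ℝ (Fin 3) ≃ₗᵢ[ℝ] EuclideanSpace ℝ (Fin 3)) (t₂ : EuclideanSpace ℝ (Fin 3))
    {u₁ : EuclideanSpace ℝ (Fin 3)} (hu₁ : u₁ ∈ fccSlots)
    (hsteep₁ : Real.sqrt 2 / 2 ≤ ⟪A₁ u₁, EuclideanSpace.single (2 : Fin 3) (1 : ℝ)⟫_ℝ)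
    {u₂ : EuclideanSpace ℝ (Fin 3)} (hu₂ : u₂ ∈ fccSlots)
    (hsteep₂ : ⟪A₂ u₂, EuclideanSpace.single (2 : Fin 3) (1 : ℝ)⟫_ℝ ≤ -(Real.sqrt 2 / 2))
    (𝓕₁ 𝓕₂ : Set (EuclideanSpace ℝ (Fin 3) ≃ₗᵢ[ℝ] EuclideanSpace ℝ (Fin 3))) (hA₁ : A₁ ∈ 𝓕₁) (hA₂ : A₂ ∈ 𝓕₂)
    (havoid₁ : ∀ G ∈ 𝓕₁, G '' fccStacking 1 (Real.sqrt (2 / 3)) ≠ A₂ '' fccStacking 1 (Real.sqrt (2 / 3)))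
    (havoid₂ : ∀ G ∈ 𝓕₂, G '' fccStacking 1 (Real.sqrt (2 / 3)) ≠ A₁ '' fccStacking 1 (Real.sqrt (2 / 3)))
    (hclosed₁ : ∀ G ∈ 𝓕₁, ∀ m : EuclideanSpace ℝ (Fin 3), ‖m‖ = 1 →
      (∀ w ∈ fccSlots, ⟪G w, m⟫_ℝ = 0 ∨ ⟪G w, m⟫_ℝ = Real.sqrt (2 / 3) ∨ ⟪G w, m⟫_ℝ = -Real.sqrt (2 / 3)) →
      ∀ G' : EuclideanSpace ℝ (Fin 3) ≃ₗᵢ[ℝ] EuclideanSpace ℝ (Fin 3),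
        (∀ x, G' x = G x - (2 * ⟪G x, m⟫_ℝ) • m) → G' ∈ 𝓕₁)
    (hclosed₂ : ∀ G ∈ 𝓕₂, ∀ m : EuclideanSpace ℝ (Fin 3), ‖m‖ = 1 →
      (∀ w ∈ fccSlots, ⟪G w, m⟫_ℝ = 0 ∨ ⟪G w, m⟫_ℝ = Real.sqrt (2 / 3) ∨ ⟪G w, m⟫_ℝ = -Real.sqrt (2 / 3)) →
      ∀ G' : EuclideanSpace ℝ (Fin 3) ≃ₗᵢ[ℝ] EuclideanSpace ℝ (Fin 3),
        (∀ x, G' x = G x - (2 * ⟪G x, m⟫_ℝ) • m) → G' ∈ 𝓕₂) :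
    ∃ C R₀ : ℝ, 1 ≤ R₀ ∧ ∀ h : ℝ, 0 ≤ h → ∀ ρ : ℝ, R₀ ≤ ρ →
      ∀ X P₁ P₂ : Finset (EuclideanSpace ℝ (Fin 3)),
      (∀ p ∈ X, ∀ q ∈ X, p ≠ q → 1 ≤ dist p q) → P₁ ⊆ X → P₂ ⊆ X \ P₁ →
      (∀ p ∈ X, -(2 * R₀) ≤ p 2 ∧ p 2 ≤ h + 2 * R₀ ∧ p 0 ^ 2 + p 1 ^ 2 ≤ ρ ^ 2) →
      (∀ p, p ∈ P₁ ↔ (p ∈ (fun q => A₁ q + t₁) '' fccStacking 1 (Real.sqrt (2 / 3)) ∧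
        -(2 * R₀) ≤ p 2 ∧ p 2 ≤ -R₀ ∧ p 0 ^ 2 + p 1 ^ 2 ≤ ρ ^ 2)) →
      (∀ p, p ∈ P₂ ↔ (p ∈ (fun q => A₂ q + t₂) '' fccStacking 1 (Real.sqrt (2 / 3)) ∧
        h + R₀ ≤ p 2 ∧ p 2 ≤ h + 2 * R₀ ∧ p 0 ^ 2 + p 1 ^ 2 ≤ ρ ^ 2)) →
      let e₃ : EuclideanSpace ℝ (Fin 3) := EuclideanSpace.single (2 : Fin 3) (1 : ℝ)
      let N : ℕ := ⌈3 * (h + 4 * R₀ + 1)⌉₊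
      let ρs : ℝ := ρ - 3 - 8 / 3 * (h + 4 * R₀)
      let S₁ := P₁.filter fun p => -(2 * R₀) + 1 ≤ p 2 ∧ p 2 ≤ -R₀ - 1 ∧ p 0 ^ 2 + p 1 ^ 2 ≤ ρs ^ 2
      let T₁ := S₁.filter fun p => p + A₁ u₁ ∉ S₁
      let E₁ := T₁.image fun p => walkEnd X e₃ N (p + A₁ u₁) [⟨A₁, u₁, 0⟩]
      let S₂ := P₂.filter fun p => h + R₀ + 1 ≤ p 2 ∧ p 2 ≤ h + 2 * R₀ - 1 ∧ p 0 ^ 2 + p 1 ^ 2 ≤ ρs ^ 2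
      let T₂ := S₂.filter fun p => p + A₂ u₂ ∉ S₂
      let E₂ := T₂.image fun p => walkEnd X (-e₃) N (p + A₂ u₂) [⟨A₂, u₂, 0⟩]
      ((((P₁ ×ˢ (X \ P₁)).filter fun pq => dist pq.1 pq.2 = 1).card : ℕ) : ℝ) +
        ((((P₂ ×ˢ ((X \ P₁) \ P₂)).filter fun pq => dist pq.1 pq.2 = 1).card : ℕ) : ℝ) ≤
        contactDeficiency ((X \ P₁) \ P₂) +
          (Real.sqrt 2 / 4 * ∑ᶠ w ∈ {w ∈ fccStacking 1 (Real.sqrt (2 / 3)) | ‖w‖ = 1},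
              |⟪w, A₁.symm (EuclideanSpace.single (2 : Fin 3) (1 : ℝ))⟫_ℝ| +
            Real.sqrt 2 / 4 * ∑ᶠ w ∈ {w ∈ fccStacking 1 (Real.sqrt (2 / 3)) | ‖w‖ = 1},
              |⟪w, A₂.symm (EuclideanSpace.single (2 : Fin 3) (1 : ℝ))⟫_ℝ| -
            (Real.sqrt 2 * |⟪A₁ u₁, EuclideanSpace.single (2 : Fin 3) (1 : ℝ)⟫_ℝ| +
              Real.sqrt 2 * |⟪A₂ u₂, EuclideanSpace.single (2 : Fin 3) (1 : ℝ)⟫_ℝ|) / 2) * Real.pi * ρ ^ 2 +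
          ((((T₁.card - E₁.card : ℕ) : ℝ) + ((T₂.card - E₂.card : ℕ) : ℝ) +
            (((E₁ ∩ E₂).filter fun y => (X.filter fun q => dist y q = 1).card = 11).card : ℝ)) / 2) +
          C * (1 + h) * ρ := by
  obtain ⟨C₁, hC₁⟩ := affineSampleDeficit_upper A₁ t₁ 10 (by norm_num)
  obtain ⟨C₂, hC₂⟩ := affineSampleDeficit_upper A₂ t₂ 10 (by norm_num)
  refine ⟨(240 * Real.sqrt 2 * Real.pi + 4440 * (4 * 10 + 2)) / 2 + 2000 + |C₁| + |C₂|, 10, by norm_num, ?_⟩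
  intro h hh ρ hρ X P₁ P₂ hX hP₁X hP₂X hcell hP₁ hP₂ e₃ N ρs S₁ T₁ E₁ S₂ T₂ E₂
  -- turn the `let`s into variables with defining equations
  have he₃def : e₃ = EuclideanSpace.single (2 : Fin 3) (1 : ℝ) := rfl
  have hNdef : N = ⌈3 * (h + 4 * 10 + 1)⌉₊ := rfl
  have hρs : ρs = ρ - 3 - 8 / 3 * (h + 4 * 10) := rfl
  have hS₁def : S₁ = P₁.filter fun p => -(2 * 10) + 1 ≤ p 2 ∧ p 2 ≤ -10 - 1 ∧ p 0 ^ 2 + p 1 ^ 2 ≤ ρs ^ 2 := rfl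
  have hT₁def : T₁ = S₁.filter fun p => p + A₁ u₁ ∉ S₁ := rfl
  have hE₁def : E₁ = T₁.image fun p => walkEnd X e₃ N (p + A₁ u₁) [⟨A₁, u₁, 0⟩] := rfl
  have hS₂def : S₂ = P₂.filter fun p => h + 10 + 1 ≤ p 2 ∧ p 2 ≤ h + 2 * 10 - 1 ∧ p 0 ^ 2 + p 1 ^ 2 ≤ ρs ^ 2 := rfl
  have hT₂def : T₂ = S₂.filter fun p => p + A₂ u₂ ∉ S₂ := rfl
  have hE₂def : E₂ = T₂.image fun p => walkEnd X (-e₃) N (p + A₂ u₂) [⟨A₂, u₂, 0⟩] := rfl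
  clear_value E₁ E₂ T₁ T₂ S₁ S₂ ρs N e₃
  subst he₃def
  set e₃ : EuclideanSpace ℝ (Fin 3) := EuclideanSpace.single (2 : Fin 3) (1 : ℝ) with he₃
  have he₃n : ‖e₃‖ = 1 := by rw [he₃, PiLp.norm_single, norm_one]
  have he₃i : ∀ d : EuclideanSpace ℝ (Fin 3), ⟪d, e₃⟫_ℝ = d 2 := fun d => by
    rw [he₃, EuclideanSpace.inner_single_right]; simp
  have hme₃n : ‖-e₃‖ = 1 := by rw [norm_neg, he₃n]
  set φ₁ : ℝ := Real.sqrt 2 / 4 * ∑ᶠ w ∈ {w ∈ fccStacking 1 (Real.sqrt (2 / 3)) | ‖w‖ = 1},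
      |⟪w, A₁.symm (EuclideanSpace.single (2 : Fin 3) (1 : ℝ))⟫_ℝ| with hφ₁
  set φ₂ : ℝ := Real.sqrt 2 / 4 * ∑ᶠ w ∈ {w ∈ fccStacking 1 (Real.sqrt (2 / 3)) | ‖w‖ = 1},
      |⟪w, A₂.symm (EuclideanSpace.single (2 : Fin 3) (1 : ℝ))⟫_ℝ| with hφ₂
  have hP₂X' : P₂ ⊆ X := hP₂X.trans Finset.sdiff_subset
  have hρ0 : (0 : ℝ) ≤ ρ := by linarith
  have hρ1 : (1 : ℝ) ≤ ρ := by linarith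
  set L : ℝ := 8 / 3 * (h + 4 * 10) with hL
  have hL0 : 0 ≤ L := by rw [hL]; positivity
  set deg : EuclideanSpace ℝ (Fin 3) → ℕ := fun x => (X.filter fun q => dist x q = 1).card with hdeg
  have hdeg12 : ∀ x, deg x ≤ 12 := fun x => card_filter_dist_eq_one_le_twelve X hX x
  set PAY := X.filter fun y => (X.filter fun q => dist y q = 1).card ≠ 12 ∧
    -10 - 2 ≤ y 2 ∧ y 2 ≤ h + 10 + 2 with hPAY
  -- the weighted interior ledger
  have hled := ledger_ge_faces_add_interior_credits A₁ t₁ A₂ t₂ X P₁ P₂ 10 h ρ le_rfl hh hρ hX hcell hP₁X hP₂X'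
    hP₁ hP₂
  rw [← finsum_unit_fcc_symm_eq_sum_slots A₁, ← finsum_unit_fcc_symm_eq_sum_slots A₂, ← hφ₁, ← hφ₂, ← hPAY] at hled
  -- fuel
  have hN : (3 : ℝ) * (h + 4 * 10 + 1) ≤ (N : ℝ) := by rw [hNdef]; exact Nat.le_ceil _
  -- fluxes
  set κ₁ : ℝ := Real.sqrt 2 * |⟪A₁ u₁, e₃⟫_ℝ| with hκ₁
  set κ₂ : ℝ := Real.sqrt 2 * |⟪A₂ u₂, e₃⟫_ℝ| with hκ₂
  have hsq : 0 ≤ Real.sqrt 2 := Real.sqrt_nonneg 2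
  have hs2' : Real.sqrt 2 ≤ 2 := by
    rw [show (2 : ℝ) = Real.sqrt (2 ^ 2) by rw [Real.sqrt_sq (by norm_num)]]
    exact Real.sqrt_le_sqrt (by norm_num)
  have hκ₁0 : 0 ≤ κ₁ := mul_nonneg hsq (abs_nonneg _)
  have hκ₂0 : 0 ≤ κ₂ := mul_nonneg hsq (abs_nonneg _)
  have hκ₁2 : κ₁ ≤ 2 := by
    have := mul_le_mul hs2' (abs_inner_slot_le_one A₁ hu₁) (abs_nonneg _) (by norm_num); linarith
  have hκ₂2 : κ₂ ≤ 2 := by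
    have := mul_le_mul hs2' (abs_inner_slot_le_one A₂ hu₂) (abs_nonneg _) (by norm_num); linarith
  have hπ : Real.pi ≤ 4 := Real.pi_le_four
  have hπ0 : 0 ≤ Real.pi := Real.pi_pos.le
  -- the residual terms are nonnegative
  have hE₁le : E₁.card ≤ T₁.card := by rw [hE₁def]; exact Finset.card_image_le
  have hE₂le : E₂.card ≤ T₂.card := by rw [hE₂def]; exact Finset.card_image_le
  have hLOST₁ : (((T₁.card - E₁.card : ℕ)) : ℝ) = (T₁.card : ℝ) - E₁.card := by push_cast [Nat.cast_sub hE₁le]; ring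
  have hLOST₂ : (((T₂.card - E₂.card : ℕ)) : ℝ) = (T₂.card : ℝ) - E₂.card := by push_cast [Nat.cast_sub hE₂le]; ring
  -- the main estimate: the payer sum dominates the tops minus residuals, up to the flux loss
  have hmain : (κ₁ + κ₂) * Real.pi * ρ ^ 2 - 2 * 2000 * (1 + h) * ρ ≤
      (∑ y ∈ PAY, ((12 : ℝ) - ((X.filter fun q => dist y q = 1).card : ℝ))) +
        (((T₁.card - E₁.card : ℕ) : ℝ) + ((T₂.card - E₂.card : ℕ) : ℝ) +
          (((E₁ ∩ E₂).filter fun y => (X.filter fun q => dist y q = 1).card = 11).card : ℝ)) := by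
    have hPAY0 : 0 ≤ ∑ y ∈ PAY, ((12 : ℝ) - ((X.filter fun q => dist y q = 1).card : ℝ)) :=
      Finset.sum_nonneg fun y _ => by
        have h' : (X.filter fun q => dist y q = 1).card ≤ 12 := hdeg12 y
        have h'' : ((X.filter fun q => dist y q = 1).card : ℝ) ≤ 12 := by exact_mod_cast h'
        linarith
    by_cases hbig : 11 + L ≤ ρ
    · -- BIG CELL: run the walkers
      have hρs8 : 8 ≤ ρs := by rw [hρs]; linarith
      have hρs0 : 0 ≤ ρs := by linarith
      have hρsρ : ρs ≤ ρ - 1 := by rw [hρs]; linarith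
      have hρs2 : ρs ^ 2 ≤ ρ ^ 2 := by nlinarith only [hρs0, hρsρ]
      -- the inner samples as clamped samples
      have hS₁ : ∀ p, p ∈ S₁ ↔ (p ∈ (fun q => A₁ q + t₁) '' fccStacking 1 (Real.sqrt (2 / 3)) ∧
          (-19 : ℝ) ≤ p 2 ∧ p 2 ≤ -19 + 8 ∧ p 0 ^ 2 + p 1 ^ 2 ≤ ρs ^ 2) := by
        intro p
        rw [hS₁def, Finset.mem_filter, hP₁]
        constructor
        · rintro ⟨⟨hΛ, -, -, -⟩, h1, h2, h3⟩
          exact ⟨hΛ, by linarith only [h1], by linarith only [h2], h3⟩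
        · rintro ⟨hΛ, h1, h2, h3⟩
          exact ⟨⟨hΛ, by linarith only [h1], by linarith only [h2], by linarith only [h3, hρs2]⟩,
            by linarith only [h1], by linarith only [h2], h3⟩
      have hS₂ : ∀ p, p ∈ S₂ ↔ (p ∈ (fun q => A₂ q + t₂) '' fccStacking 1 (Real.sqrt (2 / 3)) ∧
          (h + 11) ≤ p 2 ∧ p 2 ≤ (h + 11) + 8 ∧ p 0 ^ 2 + p 1 ^ 2 ≤ ρs ^ 2) := by
        intro p
        rw [hS₂def, Finset.mem_filter, hP₂]
        constructor
        · rintro ⟨⟨hΛ, -, -, -⟩, h1, h2, h3⟩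
          exact ⟨hΛ, by linarith only [h1], by linarith only [h2], h3⟩
        · rintro ⟨hΛ, h1, h2, h3⟩
          exact ⟨⟨hΛ, by linarith only [h1, hh], by linarith only [h2], by linarith only [h3, hρs2]⟩,
            by linarith only [h1], by linarith only [h2], h3⟩
      -- the tops counts
      obtain ⟨Ea, Eb, hEa, hEb, hdet, hframe, -⟩ := exists_frame_of_mem_fccSlots hu₁
      have hT₁ := tops_ge_lineCount A₁ t₁ (-19) 8 ρs (by norm_num) hρs8 S₁ hS₁ Ea Eb u₁ hEa hEb
        (norm_eq_one_of_mem_fccSlots hu₁) hdet hframe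
      obtain ⟨Ea', Eb', hEa', hEb', hdet', hframe', -⟩ := exists_frame_of_mem_fccSlots hu₂
      have hT₂ := tops_ge_lineCount A₂ t₂ (h + 11) 8 ρs (by norm_num) hρs8 S₂ hS₂ Ea' Eb' u₂ hEa' hEb'
        (norm_eq_one_of_mem_fccSlots hu₂) hdet' hframe'
      have hT₁' : κ₁ * Real.pi * ρs ^ 2 - 10 * Real.sqrt 2 * Real.pi * ρs ≤ (T₁.card : ℝ) := by
        rw [hT₁def]; exact hT₁
      have hT₂' : κ₂ * Real.pi * ρs ^ 2 - 10 * Real.sqrt 2 * Real.pi * ρs ≤ (T₂.card : ℝ) := by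
        rw [hT₂def]; exact hT₂
      -- flux loss from `ρ` to `ρs`
      have hflux : ∀ κ : ℝ, 0 ≤ κ → κ ≤ 2 →
          κ * Real.pi * ρ ^ 2 - 2000 * (1 + h) * ρ ≤ κ * Real.pi * ρs ^ 2 - 10 * Real.sqrt 2 * Real.pi * ρs :=
        fun κ hκ0 hκ2 => flux_loss_inner_disc hκ0 hκ2 hh hρ0 (by rw [hρs, hL]) hρs0 hρsρ
      have hT₁'' : κ₁ * Real.pi * ρ ^ 2 - 2000 * (1 + h) * ρ ≤ (T₁.card : ℝ) := le_trans (hflux κ₁ hκ₁0 hκ₁2) hT₁'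
      have hT₂'' : κ₂ * Real.pi * ρ ^ 2 - 2000 * (1 + h) * ρ ≤ (T₂.card : ℝ) := le_trans (hflux κ₂ hκ₂0 hκ₂2) hT₂'
      -- the ends of grain 1: payers in the interior window (no arrivals: frames stay in `𝓕₁`)
      have hρs3 : ρs ^ 2 ≤ (ρ - 1) ^ 2 := by nlinarith only [hρs0, hρsρ]
      have hρ2' : 0 ≤ ρ - 2 := by linarith only [hρ]
      have hlat_of : ∀ (y₀ y : EuclideanSpace ℝ (Fin 3)) (p : EuclideanSpace ℝ (Fin 3)) (v : EuclideanSpace ℝ (Fin 3)),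
          y₀ = p + v → ‖v‖ = 1 → p 0 ^ 2 + p 1 ^ 2 ≤ ρs ^ 2 → ‖y - y₀‖ ≤ L → y 0 ^ 2 + y 1 ^ 2 ≤ (ρ - 2) ^ 2 := by
        intro y₀ y p v hy₀ hv hp3 hd
        have h1 := sqrt_lateral_add_le y₀ (y - y₀)
        rw [add_sub_cancel] at h1
        have h2 := sqrt_lateral_add_le p v
        rw [hv, ← hy₀] at h2
        have h3 : Real.sqrt (p 0 ^ 2 + p 1 ^ 2) ≤ ρs := by
          rw [← Real.sqrt_sq hρs0]; exact Real.sqrt_le_sqrt hp3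
        have h4 : Real.sqrt (y 0 ^ 2 + y 1 ^ 2) ≤ ρ - 2 := by rw [hρs] at h3; linarith only [h1, h2, h3, hd]
        have h5 := Real.sq_sqrt (by positivity : (0 : ℝ) ≤ y 0 ^ 2 + y 1 ^ 2)
        have h7 := pow_le_pow_left₀ (Real.sqrt_nonneg (y 0 ^ 2 + y 1 ^ 2)) h4 2
        rw [h5] at h7
        exact h7
      have hend₁ : ∀ y ∈ E₁, y ∈ PAY := by
        intro y hy
        rw [hE₁def] at hy
        obtain ⟨p, hp, rfl⟩ := Finset.mem_image.1 hy
        rw [hT₁def] at hp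
        have hpS : p ∈ S₁ := (Finset.mem_filter.1 hp).1
        obtain ⟨hpΛ, hp1, hp2, hp3⟩ := (hS₁ p).1 hpS
        have hpP : p ∈ P₁ := by rw [hS₁def] at hpS; exact (Finset.mem_filter.1 hpS).1
        have hpX : p ∈ X := hP₁X hpP
        have hfull : ∀ w ∈ fccSlots, p + A₁ w ∈ X := fun w hw =>
          hP₁X (inner_sample_full_window A₁ t₁ P₁ (-(2 * 10)) (-10) ρ hρ1 hP₁ hpΛ (by linarith only [hp1])
            (by linarith only [hp2]) (by linarith only [hp3, hρs3]) hw)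
        have hH : ∀ q ∈ X, ⟪q, e₃⟫_ℝ ≤ h + 20 := fun q hq => by rw [he₃i]; linarith only [(hcell q hq).2.1]
        have hy0X : p + A₁ u₁ ∈ X := hfull u₁ hu₁
        have hy02 : -20 ≤ (p + A₁ u₁) 2 := by linarith only [(hcell _ hy0X).1]
        have hNh : 8 * (h + 20 - ⟪p + A₁ u₁, e₃⟫_ℝ) < 3 * (N : ℝ) := by rw [he₃i]; linarith only [hN, hy02, hh]
        obtain ⟨hyX, hydeg, hrise, hdisp⟩ := grainWalk_end hX hs₀ hcert he₃n hH A₁ hpX hfull hu₁ hsteep₁ hNh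
        have hy0eq : (p + A₁ u₁) 2 = p 2 + ⟪A₁ u₁, e₃⟫_ℝ := by rw [PiLp.add_apply, ← he₃i (A₁ u₁)]
        rw [he₃i] at hdisp
        have hlat2 := hlat_of (p + A₁ u₁) (walkEnd X e₃ N (p + A₁ u₁) [⟨A₁, u₁, 0⟩]) p (A₁ u₁) rfl
          (by rw [LinearIsometryEquiv.norm_map, norm_eq_one_of_mem_fccSlots hu₁]) hp3
          (by rw [hL]; linarith only [hdisp, hy02])
        have hnothigh := stackWalk_end_not_high hX hs₀ hcert A₂ t₂ P₂ 10 h ρ (by linarith only [hρ]) hP₂X'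
          (fun q hq => (hcell q hq).2.1) hP₂ 𝓕₁ havoid₁ hclosed₁ he₃n hH (walkInv_start A₁ hpX hfull hu₁ hsteep₁)
          (fun e' he' => by simp only [List.mem_singleton] at he'; rw [he']; exact hA₁) hNh hlat2
        have hylat : (walkEnd X e₃ N (p + A₁ u₁) [⟨A₁, u₁, 0⟩]) 0 ^ 2 +
            (walkEnd X e₃ N (p + A₁ u₁) [⟨A₁, u₁, 0⟩]) 1 ^ 2 ≤ (ρ - 1) ^ 2 := le_trans hlat2 (by nlinarith only [hρ])
        rw [hPAY, Finset.mem_filter]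
        refine ⟨hyX, by show deg _ ≠ 12; exact fun h12 => by simp only [hdeg] at h12; omega, ?_, le_of_lt hnothigh⟩
        -- not inside the bottom slab
        rw [inner_sub_left, he₃i, he₃i] at hrise
        by_contra hlow
        push Not at hlow
        have hsqrt0 : 0 ≤ Real.sqrt 2 / 2 := by positivity
        exact not_unsaturated_in_slab A₁ t₁ (-(2 * 10)) (-10) ρ hρ1 X P₁ hX hP₁X hP₁ hyX
          (by linarith only [hrise, hy0eq, hp1, hsteep₁, hsqrt0]) (by linarith only [hlow]) hylat hydeg
      -- the ends of grain 2
      have hend₂ : ∀ y ∈ E₂, y ∈ PAY := by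
        intro y hy
        rw [hE₂def] at hy
        obtain ⟨p, hp, rfl⟩ := Finset.mem_image.1 hy
        rw [hT₂def] at hp
        have hpS : p ∈ S₂ := (Finset.mem_filter.1 hp).1
        obtain ⟨hpΛ, hp1, hp2, hp3⟩ := (hS₂ p).1 hpS
        have hpP : p ∈ P₂ := by rw [hS₂def] at hpS; exact (Finset.mem_filter.1 hpS).1
        have hpX : p ∈ X := hP₂X' hpP
        have hfull : ∀ w ∈ fccSlots, p + A₂ w ∈ X := fun w hw =>
          hP₂X' (inner_sample_full_window A₂ t₂ P₂ (h + 10) (h + 2 * 10) ρ hρ1 hP₂ hpΛ (by linarith only [hp1])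
            (by linarith only [hp2]) (by linarith only [hp3, hρs3]) hw)
        have hH : ∀ q ∈ X, ⟪q, -e₃⟫_ℝ ≤ 20 := fun q hq => by
          rw [inner_neg_right, he₃i]; linarith only [(hcell q hq).1]
        have hy0X : p + A₂ u₂ ∈ X := hfull u₂ hu₂
        have hy02 : (p + A₂ u₂) 2 ≤ h + 20 := by linarith only [(hcell _ hy0X).2.1]
        have hy02' : -20 ≤ (p + A₂ u₂) 2 := by linarith only [(hcell _ hy0X).1]
        have hNh : 8 * (20 - ⟪p + A₂ u₂, -e₃⟫_ℝ) < 3 * (N : ℝ) := by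
          rw [inner_neg_right, he₃i]; linarith only [hN, hy02, hh]
        have hsteep₂' : Real.sqrt 2 / 2 ≤ ⟪A₂ u₂, -e₃⟫_ℝ := by rw [inner_neg_right]; linarith only [hsteep₂]
        obtain ⟨hyX, hydeg, hrise, hdisp⟩ := grainWalk_end hX hs₀ hcert hme₃n hH A₂ hpX hfull hu₂ hsteep₂' hNh
        have hy0eq : (p + A₂ u₂) 2 = p 2 + ⟪A₂ u₂, e₃⟫_ℝ := by rw [PiLp.add_apply, ← he₃i (A₂ u₂)]
        rw [inner_neg_right, he₃i] at hdisp
        have hlat2 := hlat_of (p + A₂ u₂) (walkEnd X (-e₃) N (p + A₂ u₂) [⟨A₂, u₂, 0⟩]) p (A₂ u₂) rfl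
          (by rw [LinearIsometryEquiv.norm_map, norm_eq_one_of_mem_fccSlots hu₂]) hp3
          (by rw [hL]; linarith only [hdisp, hy02, hy02', hh])
        have hnotlow := stackWalk_end_not_low hX hs₀ hcert A₁ t₁ P₁ 10 ρ (by linarith only [hρ]) hP₁X
          (fun q hq => (hcell q hq).1) hP₁ 𝓕₂ havoid₂ hclosed₂ hme₃n hH (walkInv_start A₂ hpX hfull hu₂ hsteep₂')
          (fun e' he' => by simp only [List.mem_singleton] at he'; rw [he']; exact hA₂) hNh hlat2
        have hylat : (walkEnd X (-e₃) N (p + A₂ u₂) [⟨A₂, u₂, 0⟩]) 0 ^ 2 +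
            (walkEnd X (-e₃) N (p + A₂ u₂) [⟨A₂, u₂, 0⟩]) 1 ^ 2 ≤ (ρ - 1) ^ 2 := le_trans hlat2 (by nlinarith only [hρ])
        rw [hPAY, Finset.mem_filter]
        refine ⟨hyX, by show deg _ ≠ 12; exact fun h12 => by simp only [hdeg] at h12; omega, ?_, ?_⟩
        · have : (-10 : ℝ) - 2 < (walkEnd X (-e₃) N (p + A₂ u₂) [⟨A₂, u₂, 0⟩]) 2 := hnotlow
          linarith only [this]
        -- not inside the top slab
        rw [inner_sub_left, inner_neg_right, inner_neg_right, he₃i, he₃i] at hrise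
        by_contra hhigh
        push Not at hhigh
        have hsqrt0 : 0 ≤ Real.sqrt 2 / 2 := by positivity
        exact not_unsaturated_in_slab A₂ t₂ (h + 10) (h + 2 * 10) ρ hρ1 X P₂ hX hP₂X' hP₂ hyX
          (by linarith only [hhigh]) (by linarith only [hrise, hy0eq, hp2, hsteep₂, hsqrt0]) hylat hydeg
      -- the weighted payer sum dominates `#E₁ + #E₂ − #DT`
      set DT := (E₁ ∩ E₂).filter fun y => (X.filter fun q => dist y q = 1).card = 11 with hDT
      have hU₁P : E₁ ⊆ PAY := fun y hy => hend₁ y hy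
      have hU₂P : E₂ ⊆ PAY := fun y hy => hend₂ y hy
      have hUU : ∀ y ∈ E₁ ∩ E₂, deg y = 11 → y ∈ DT := by
        intro y hy h11
        rw [hDT, Finset.mem_filter]
        exact ⟨hy, h11⟩
      have hPAYge : (E₁.card : ℝ) + E₂.card - DT.card ≤
          ∑ y ∈ PAY, ((12 : ℝ) - ((X.filter fun q => dist y q = 1).card : ℝ)) :=
        sum_payers_ge_two_families hX hU₁P hU₂P (fun y hy => by
          rw [hPAY, Finset.mem_filter] at hy; exact hy.2.1) hUU
      rw [hLOST₁, hLOST₂]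
      linarith only [hPAYge, hT₁'', hT₂'']
    · -- SMALL CELL: the flux is within the error
      push Not at hbig
      have hsmall : (κ₁ + κ₂) * Real.pi * ρ ^ 2 ≤ 2 * 2000 * (1 + h) * ρ := by
        have h1 : (κ₁ + κ₂) * Real.pi ≤ 16 := by nlinarith only [hκ₁0, hκ₂0, hκ₁2, hκ₂2, hπ, hπ0]
        have hρ2 : 0 ≤ ρ ^ 2 := sq_nonneg ρ
        have h2 : (κ₁ + κ₂) * Real.pi * ρ ^ 2 ≤ 16 * ρ ^ 2 := mul_le_mul_of_nonneg_right h1 hρ2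
        have h3 : ρ ^ 2 ≤ ρ * (11 + L) := by
          rw [sq]; exact mul_le_mul_of_nonneg_left hbig.le hρ0
        have hhρ : 0 ≤ h * ρ := mul_nonneg hh hρ0
        rw [hL] at h3
        linarith only [h2, h3, hρ0, hhρ]
      have hres : 0 ≤ (((T₁.card - E₁.card : ℕ) : ℝ) + ((T₂.card - E₂.card : ℕ) : ℝ) +
          (((E₁ ∩ E₂).filter fun y => (X.filter fun q => dist y q = 1).card = 11).card : ℝ)) :=
        add_nonneg (add_nonneg (Nat.cast_nonneg _) (Nat.cast_nonneg _)) (Nat.cast_nonneg _)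
      linarith only [hsmall, hres, hPAY0]
  -- the two upper slab counts and the two splits
  have hD₁ := hC₁ (-(2 * 10)) (-10) (by ring) ρ hρ P₁ hP₁
  have hD₂ := hC₂ (h + 10) (h + 2 * 10) (by ring) ρ hρ P₂ hP₂
  have hsplit₁ := contactDeficiency_sdiff_split hP₁X
  have hsplit₂ := contactDeficiency_sdiff_split hP₂X
  have htwo := two_mul_contactDeficiency_eq_sum X
  -- constants
  have hb : C₁ * ρ ≤ |C₁| * (1 + h) * ρ := by
    have h1 : 0 ≤ (|C₁| - C₁) * ρ := mul_nonneg (by linarith only [le_abs_self C₁]) hρ0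
    have h2 : 0 ≤ |C₁| * h * ρ := by positivity
    linarith only [h1, h2]
  have hc' : C₂ * ρ ≤ |C₂| * (1 + h) * ρ := by
    have h1 : 0 ≤ (|C₂| - C₂) * ρ := mul_nonneg (by linarith only [le_abs_self C₂]) hρ0
    have h2 : 0 ≤ |C₂| * h * ρ := by positivity
    linarith only [h1, h2]
  have hhρ : 0 ≤ h * ρ := mul_nonneg hh hρ0
  -- assemble
  set RES : ℝ := (((T₁.card - E₁.card : ℕ) : ℝ) + ((T₂.card - E₂.card : ℕ) : ℝ) +
      (((E₁ ∩ E₂).filter fun y => (X.filter fun q => dist y q = 1).card = 11).card : ℝ)) with hRES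
  set SP : ℝ := ∑ y ∈ PAY, ((12 : ℝ) - ((X.filter fun q => dist y q = 1).card : ℝ)) with hSP
  set C₀ : ℝ := 240 * Real.sqrt 2 * Real.pi + 4440 * (4 * 10 + 2) with hC₀
  have hDX : φ₁ * Real.pi * ρ ^ 2 + φ₂ * Real.pi * ρ ^ 2 + SP / 2 - C₀ * (1 + h) * ρ / 2 ≤ contactDeficiency X := by
    linarith only [hled, htwo]
  have hcross : ((((P₁ ×ˢ (X \ P₁)).filter fun pq => dist pq.1 pq.2 = 1).card : ℕ) : ℝ) +
      ((((P₂ ×ˢ ((X \ P₁) \ P₂)).filter fun pq => dist pq.1 pq.2 = 1).card : ℕ) : ℝ) =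
      contactDeficiency P₁ + contactDeficiency P₂ + contactDeficiency ((X \ P₁) \ P₂) - contactDeficiency X := by
    linarith only [hsplit₁, hsplit₂]
  rw [hcross]
  have hSP : (κ₁ + κ₂) * Real.pi * ρ ^ 2 / 2 - 2000 * (1 + h) * ρ - RES / 2 ≤ SP / 2 := by
    linarith only [hmain]
  have hC₀0 : 0 ≤ C₀ * (1 + h) * ρ := by positivity
  nlinarith only [hDX, hSP, hD₁, hD₂, hb, hc', hC₀0, hρ0, hh, hhρ]

end Summit.Ventures.Crystal3D.Theorems

end
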